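import Summits.BirchSwinnertonDyer.BirchSwinnertonDyer.Theorems.GenusKolyvaginAtTwoPowDvdShaCardAtTwoPosTBottomRungTransverseSocketTransposition
import Summits.BirchSwinnertonDyer.BirchSwinnertonDyer.Theorems.GenusKolyvaginAtTwoMinimalTwinBSDTwoBridges
import Summits.BirchSwinnertonDyer.BirchSwinnertonDyer.Theorems.Rank1ResidualJetRingClassFields
import HarnessLib

/-!
# Route `GenusKolyvaginAtTwo`, crux L⁺_T′ `PowDvdShaCardAtTwoPosT` (stmt-BirchSwinnertonDyer-25501), road «E4⁺» — LAYER 12: THE SOCKET hbot⁺ IN THE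
# (E4)⁺ SKELETON'S OWN SPELLING (gk2-p2 g22's `stub_bottomRungTransposition` of HOME `line23379/plus_descent_e4pos_gk2p2.lean`, VERBATIM signature)

Seat `bsd-line-gk2-p4` g24 (WIDTH-5 attach, cell `bsd-f1-sign2`), `--supports stmt-BirchSwinnertonDyer-25501 --as helper`.
THEOREM ONLY (no definition, no named fact, no `sorry`).  BSD is NOT proved by any of this; L⁺_T′ / Q4_T are NOT claimed; nothing is closed.

WHAT.  `bottomRungTransposition_of_witness` — for `K` imaginary quadratic (`d_K` odd `≠ −3`, Heegner, the two non-squares of the frame), `E` non-CM with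
odd Tamagawa product, `ρ_{E,2^n}` onto for all `n ≥ 1`, an odd place `v ∣ N` of multiplicative reduction, and a transposition-deep level-`2` witness
(`n₀` square-free of Zhang–Kolyvagin primes of index `≥ 2` each carrying the transposition clause, a datum `e₀` on `n₀` with `P(n₀) ∉ 2E(K[n₀])`),
modulo Q2 `KolyvaginRelationAtTwo`: a square-free `n` of Zhang–Kolyvagin primes of index `≥ 2(M₀+6)` in the margin class
«index `≥ 2(M₀+6)+1` ∧ transposition clause» with `addOrderOf c_{2(M₀+6)}(n) = 2^{2(M₀+6)}`.  This is layer 11's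
`TransverseValue.hbot_socket_margin_onHabitat_of_three_le_transposition` at `L := 2(M₀+6)`, `k := 1`, `G q := L + 1 ≤ idx q ∧ TRANSP q`, with the
ring-class-field instances (`JET.numberField_ringClassField`) and the surjectivity respelling (`MinimalTwinBSDTwo.forall_hasSurjectiveModNGaloisRep_two_pow_of_pos`)
supplied — the signature is gk2-p2 g22's displayed stub `stub_bottomRungTransposition` VERBATIM (its binders `τ`, `τ ≠ 1` are not used).

HONEST FRAMING.  Glue; closes nothing; BSD is not proved.

References: [McCallumLMS1991] §5 Prop. 5.2 and its proof (p. 285); [Kolyvagin1991MathAnn] Thm. 2.2; [GrossLMS1991] §3 (3.1)–(3.3).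
-/

set_option autoImplicit false
-- the Theorems namespace of this sub repeats the summit name by design (D-0017 nested layout)
set_option linter.dupNamespace false

noncomputable section

open scoped Classical

open WeierstrassCurve NumberField IsDedekindDomain Field
open Literature.NumberTheory.EllipticCurves Literature.NumberTheory.GaloisRepresentations
open Literature.NumberTheory.GaloisCohomology
open Literature.NumberTheory.EllipticCurves.ModularForms
open Summit.BirchSwinnertonDyer.Rank1Residual
open Summit.BirchSwinnertonDyer.BirchSwinnertonDyer.Theses.GenusKolyvaginAtTwo (KolyvaginRelationAtTwo)

namespace Summit.BirchSwinnertonDyer.BirchSwinnertonDyer.Theorems.GenusExact.PlusDescent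

/-- **hbot⁺ in the (E4)⁺ skeleton's spelling** (gk2-p2 g22's `stub_bottomRungTransposition`, VERBATIM signature): from the transposition-deep level-`2`
witness `P(n₀) ∉ 2E(K[n₀])` on the cut habitat, modulo Q2, a `2`-primitive bottom rung `c_L(n)` of exact order `2^L`, `L = 2(M₀+6)`, all of whose primes
are Zhang–Kolyvagin of index `≥ L + 1` carrying the transposition clause.  (`τ`, `τ ≠ 1` unused.)
[cite: McCallumLMS1991, §5 Prop. 5.2 and its proof, p. 285] [cite: Kolyvagin1991MathAnn, Thm. 2.2] [cite: GrossLMS1991, §3 (3.1)–(3.3)] -/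
theorem bottomRungTransposition_of_witness : KolyvaginRelationAtTwo → ∀ (W : WeierstrassCurve ℚ) [W.IsElliptic] [W.IsGloballyMinimal]
    [NeZero (W.conductorNorm ℤ)],
    ¬ W.HasCM → Odd W.tamagawaProduct → ∀ (v : HeightOneSpectrum (𝓞 ℚ)), ((2 : ℕ) : 𝓞 ℚ) ∉ v.asIdeal →
    ((W.conductorNorm ℤ : ℕ) : 𝓞 ℚ) ∈ v.asIdeal → W.HasMultiplicativeReductionAt v →
    ∀ (K : Type) [Field K] [NumberField K], IsImaginaryQuadratic K → Odd (NumberField.discr K) → NumberField.discr K ≠ -3 →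
    SatisfiesHeegnerHypothesis (W.conductorNorm ℤ) K → ¬ IsSquare ((NumberField.discr K : ℚ) * -|W.Δ|) →
    ¬ IsSquare ((NumberField.discr K : ℚ) * (-(2 * |W.Δ|))) → (∀ n : ℕ, 0 < n → W.HasSurjectiveModNGaloisRep ((2 : ℤ) ^ n)) →
    ∀ (τ : K ≃ₐ[ℚ] K), τ ≠ 1 → ∀ (Dt : ModularParametrizationData W (W.conductorNorm ℤ)) (β : ℤ) (ι : K →+* ℂ) (M₀ : ℕ),
    ∀ (n₀ : ℕ) (e₀ : KolyvaginHeegnerData Dt β ι n₀), Squarefree n₀ →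
    (∀ ℓ ∈ n₀.primeFactors, Zhang2014.IsKolyvaginPrime (W.conductorNorm ℤ) W K 2 ℓ ∧ 2 ≤ Zhang2014.kolyvaginIndex W 2 ℓ ∧
      (∃ (v : HeightOneSpectrum (𝓞 ℚ)) (𝔓 : Ideal (absIntegers (𝓞 ℚ) ℚ)) (h : absoluteGaloisGroup ℚ),
            (ℓ : 𝓞 ℚ) ∈ v.asIdeal ∧ 𝔓 ∈ v.primesAbove ∧ IsArithFrobAt (𝓞 ℚ) h 𝔓 ∧ ∃ u : geomTorsion W 2, h • u ≠ u)) →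
    (¬ ∃ Q : (W.baseChange (ringClassField K ι n₀)).toAffine.Point, (2 : ℤ) • Q = e₀.derivedPoint) →
    ∃ (n : ℕ) (d : KolyvaginHeegnerData Dt β ι n), Squarefree n ∧
      (∀ q ∈ n.primeFactors, (Zhang2014.IsKolyvaginPrime (W.conductorNorm ℤ) W K 2 q ∧ 2 * (M₀ + 6) ≤ Zhang2014.kolyvaginIndex W 2 q) ∧
        (2 * (M₀ + 6) + 1 ≤ Zhang2014.kolyvaginIndex W 2 q ∧
          (∃ (v : HeightOneSpectrum (𝓞 ℚ)) (𝔓 : Ideal (absIntegers (𝓞 ℚ) ℚ)) (h : absoluteGaloisGroup ℚ),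
            (q : 𝓞 ℚ) ∈ v.asIdeal ∧ 𝔓 ∈ v.primesAbove ∧ IsArithFrobAt (𝓞 ℚ) h 𝔓 ∧ ∃ u : geomTorsion W 2, h • u ≠ u))) ∧
      addOrderOf (d.kolyvaginClass Nat.prime_two (2 * (M₀ + 6))) = 2 ^ (2 * (M₀ + 6)) := by
  intro hQ2 W _ _ _ hcm hT v h2v hNv hmult K _ _ hIQ hodd h3 hHe hsq1 hsq2 hρ _τ _ Dt β ι M₀ n₀ e₀ hn₀ hn₀K he₀
  haveI : ∀ j : ℕ, NumberField (ringClassField K ι j) := JET.numberField_ringClassField K hIQ ι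
  have hsurN' : ∀ m : ℕ, W.HasSurjectiveModNGaloisRep (2 ^ m : ℕ) := fun m ↦ by
    exact_mod_cast MinimalTwinBSDTwo.forall_hasSurjectiveModNGaloisRep_two_pow_of_pos W hρ m
  exact TransverseValue.hbot_socket_margin_onHabitat_of_three_le_transposition W hQ2 hcm hT hsurN' hIQ hodd h3 hHe hsq1 hsq2 h2v hNv
    hmult Dt β ι (L := 2 * (M₀ + 6)) (by omega) 1 (by omega)
    (fun q ↦ 2 * (M₀ + 6) + 1 ≤ Zhang2014.kolyvaginIndex W 2 q ∧
      ∃ (v : HeightOneSpectrum (𝓞 ℚ)) (𝔓 : Ideal (absIntegers (𝓞 ℚ) ℚ)) (h : absoluteGaloisGroup ℚ),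
        (q : 𝓞 ℚ) ∈ v.asIdeal ∧ 𝔓 ∈ v.primesAbove ∧ IsArithFrobAt (𝓞 ℚ) h 𝔓 ∧ ∃ u : geomTorsion W 2, h • u ≠ u)
    (fun q _ hidx hF ↦ ⟨hidx, hF⟩) hn₀ hn₀K e₀ he₀

end Summit.BirchSwinnertonDyer.BirchSwinnertonDyer.Theorems.GenusExact.PlusDescent

end
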